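import Literature.NumberTheory.Sieve.Maynard2016Prop92MainDecomposition
import Literature.NumberTheory.Sieve.Maynard2016Prop92LocalPairSumTotal
import Literature.NumberTheory.Sieve.FGKMT2018Prop91EDiffCounting
import Literature.NumberTheory.Sieve.Maynard2016Lemma93Frame
import HarnessLib

/-!
# Maynard 2016, Prop. 9.2 (`𝒜 = ℤ`): the `y^{(m)}`-difference error `E_diff^{(m)}` — kernel bound (leaf M3, part a)

Source: J. Maynard, *Dense clusters of primes in subsets*, Compositio Math. 152 (2016) 1517–1554 =
arXiv:1405.2593v3 [Maynard2016DenseClusters], proof of Proposition 9.2, p. 22, displays (9.14)–(9.18)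
(«Thus we may write `Σ'_r (y_r^{(m)})²/φ_ω(r)² Σ'_s T^{(m)}_{r,s} + Σ'_{r,s} y_r^{(m)}(y_s^{(m)} − y_r^{(m)})
T^{(m)}_{r,s}/φ_ω(r)²` … we see that `y_s^{(m)} = y_r^{(m)} + O(T_k (Y_r + Y_s) log A/(k log R))` analogously
to Lemma 8.2 … the second term above contributes `≪ … Σ_A (log A) ω(A)/φ_ω(A)² Σ_{r'} Y_{r'}² φ(r')/φ_ω(r')²`»),
with Lemma 8.2 p. 15 and Lemma 9.3 p. 23; K. Ford, B. Green, S. Konyagin, J. Maynard, T. Tao, *Long gaps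
between primes*, J. Amer. Math. Soc. 31 (2018) 65–105 [FordGreenKonyaginMaynardTao2018], Theorem 6 (7.13).

This file reduces the leaf `Maynard2016Prop92EDiffBound` (M3 of `Maynard2016Prop92MainDecomposition`:
`E_diff^{(m)} = Σ_{r,s ∈ 𝒟'} y_r (y_s − y_r) T^{(m)}(r,s)/φ_ω(∏r)²`, `ediffM`) to ONE `(k−1)`-fold sum
`Σ_{r ∈ 𝒟'} (∫ F₂(u(r); t_m) dt_m)² · w(∏r)` with the Prop-9.1 weight `w(N) = ∏_{q∣N}(q+k−2)/φ_ω(N)²`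
(`wRatio`), GIVEN the pointwise Lemma-9.3 approximation `y_r^{(m)} = c·∫F(u(r); t_m)dt_m + O(δ c ∫F₂ dt_m)`
as a hypothesis (it is the statement `Maynard2016Lemma93Z`).  The combinatorics of the pairs `(r, s)` with
`∏r = ∏s` (matched / mismatched primes, `A(r,s)`, the count of the `s`) is literally that of Prop. 9.1
(`FGKMT2018Prop91EDiffPointwise`, `FGKMT2018Prop91EDiffCounting`): the `φ_𝓛`-twisted pair sum satisfies
`|T^{(m)}(r,s)| ≤ ∏_{p∣(r,s)}(p−1)` (§1) and `𝒟' ⊆ 𝒟_k`.  What is new is (§2–§3) the MARGINAL form of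
Lemma 8.2 — `|∫F(u(s);t)dt − ∫F(u(r);t)dt| ≤ (30+30/U_k+T_k)(log A/log R)(∫F₂(u(r);t)dt + ∫F₂(u(s);t)dt)` —
and (§4–§5) the symmetrised summation with the extra `δ`-terms of Lemma 9.3, regrouped `r = p·r'` exactly as
in `sum_F₂_sq_kernel_le` but over `𝒟'` and for a general weight antitone under removing primes.

Final statement: `abs_ediffM_le_of_approx`.
-/

noncomputable section

open Finset Real MeasureTheory

namespace Literature.NumberTheory.Sieve.FGKMT2018

variable {k : ℕ}

/-! ### §1 `|T^{(m)}(r,s)| ≤ ∏_{p ∣ (r,s)} (p − 1)` -/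

/-- **`|T^{(m)}(r,s)| ≤ ∏_{p∣(r,s)}(p − 1)`** for `r, s ∈ 𝒟'` with `∏rᵢ = ∏sᵢ`: by (9.12) the local factor is
`φ_L(p) − 1 ∈ {p − 2, p − 1}` at a matched prime and `−1` at a mismatched one.
[cite: Maynard2016DenseClusters, proof of Prop. 9.2 p. 22, (9.12); proof of Prop. 9.1 p. 19, (9.5)] -/
theorem abs_localPairSumM_le_matchWt {L : Fin k → ℤ × ℤ} {B : ℕ} {R : ℝ} {m : Fin k}
    (hl : (L m).1 ≠ 0) {r s : Fin k → ℕ} (hr : r ∈ dkBoxP L B R m) (hs : s ∈ dkBoxP L B R m)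
    (heq : (∏ i, r i) = ∏ i, s i) :
    |localPairSumM L B R m r s| ≤ matchWt r s (∏ i, r i) := by
  classical
  rw [localPairSumM_eq_prod_localFactorM hl hr hs heq, Finset.abs_prod]
  unfold matchWt
  refine Finset.prod_le_prod (fun p _ => abs_nonneg _) fun p hp => ?_
  have hpp := Nat.prime_of_mem_primeFactors hp
  have h2 : (2 : ℝ) ≤ p := by exact_mod_cast hpp.two_le
  have htot : totForm (L m) p ≤ p := by
    rw [totForm_prime (L m) hl hpp]; split_ifs <;> linarith
  have htot' : (p : ℝ) - 1 ≤ totForm (L m) p := by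
    rw [totForm_prime (L m) hl hpp]; split_ifs <;> linarith
  unfold localFactorM Matched
  split_ifs
  · rw [abs_of_nonneg (by linarith)]; linarith
  · simp

/-! ### §2 The marginal integrals `∫₀^∞ F(u; t_m) dt_m`, `∫₀^∞ F₂(u; t_m) dt_m` (`margInt`) -/

/-- `t ↦ F(u; u_m := t)` is integrable on `[0, ∞)` for `u` in the orthant (`0 ≤ F ≤ F₁ ≤ F₂`, `F₂` fibrewise
integrable). [cite: Maynard2016DenseClusters, Lemma 8.6 (trivial bounds `F ≤ F₁`, `k F₁ ≤ F₂`), proof of Lemma 9.3 p. 24 («∫₀^∞ F₂ dt_m»)] -/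
theorem integrableOn_F_update (hk : 2 ≤ k) {u : Fin k → ℝ} (hu : u ∈ MaynardDense.orthant k)
    (m : Fin k) :
    IntegrableOn (fun t => MaynardDense.F k (Function.update u m t)) (Set.Ici 0) := by
  refine Integrable.mono' (MaynardDense.integrableOn_F₂_update hk u m)
    ((MaynardDense.measurable_F k).comp (measurable_update u)).aestronglyMeasurable ?_
  refine ae_restrict_of_forall_mem measurableSet_Ici fun t ht => ?_
  have hut := MaynardDense.update_mem_orthant hu m ht
  have hF0 := MaynardDense.F_nonneg hk hut
  have hk1 : (1 : ℝ) ≤ k := by exact_mod_cast (le_trans (by norm_num) hk : 1 ≤ k)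
  rw [Real.norm_eq_abs, abs_of_nonneg hF0]
  have h1 := MaynardDense.F_le_F₁ hk hut
  have h2 := MaynardDense.mul_F₁_le_F₂ hk hut
  have hF1 : 0 ≤ MaynardDense.F₁ k (Function.update u m t) := hF0.trans h1
  nlinarith

/-- **`k ∫₀^∞ F(u;t_m)dt_m ≤ ∫₀^∞ F₂(u;t_m)dt_m`** (`F ≤ F₁`, `kF₁ ≤ F₂` fibrewise) — the marginal form of
«`y_r ≤ Y_r/k`». [cite: Maynard2016DenseClusters, proof of Prop. 9.1 p. 19 («y_r ≪ Y_r/k»), Lemma 8.6, proof of Prop. 9.2 p. 22 (9.16)] -/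
theorem mul_margInt_F_le_margInt_F₂ (hk : 2 ≤ k) {u : Fin k → ℝ} (hu : u ∈ MaynardDense.orthant k)
    (m : Fin k) :
    (k : ℝ) * margInt m (MaynardDense.F k) u ≤ margInt m (MaynardDense.F₂ k) u := by
  unfold margInt
  rw [← integral_const_mul]
  refine integral_mono_of_nonneg
    (ae_restrict_of_forall_mem measurableSet_Ici fun t ht => mul_nonneg (Nat.cast_nonneg k)
      (MaynardDense.F_nonneg hk (MaynardDense.update_mem_orthant hu m ht)))
    (MaynardDense.integrableOn_F₂_update hk u m)
    (ae_restrict_of_forall_mem measurableSet_Ici fun t ht => ?_)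
  have hut := MaynardDense.update_mem_orthant hu m ht
  have h1 := MaynardDense.F_le_F₁ hk hut
  have h2 := MaynardDense.mul_F₁_le_F₂ hk hut
  have hk0 : (0 : ℝ) ≤ k := Nat.cast_nonneg k
  exact (mul_le_mul_of_nonneg_left h1 hk0).trans h2

/-- **`∫₀^∞ F₂(·;t_m)dt_m` is antitone** in the other coordinates (integrate `F₂_anti`): the marginal form of
`Y_{r} ≤ Y_{r'}` for `r' ∣ r`. [cite: Maynard2016DenseClusters, Lemma 8.2 (monotonicity of F₂), proof of Prop. 9.2 p. 22 («letting r = A r'»)] -/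
theorem margInt_F₂_anti (hk : 2 ≤ k) {u v : Fin k → ℝ} (hu : u ∈ MaynardDense.orthant k)
    (huv : ∀ i, u i ≤ v i) (m : Fin k) :
    margInt m (MaynardDense.F₂ k) v ≤ margInt m (MaynardDense.F₂ k) u := by
  have hv : v ∈ MaynardDense.orthant k :=
    MaynardDense.mem_orthant.2 fun i => (MaynardDense.mem_orthant.1 hu i).trans (huv i)
  unfold margInt
  refine integral_mono_of_nonneg
    (ae_restrict_of_forall_mem measurableSet_Ici fun t ht =>
      MaynardDense.F₂_nonneg hk (MaynardDense.update_mem_orthant hv m ht))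
    (MaynardDense.integrableOn_F₂_update hk u m)
    (ae_restrict_of_forall_mem measurableSet_Ici fun t ht => ?_)
  refine MaynardDense.F₂_anti hk (MaynardDense.update_mem_orthant hu m ht) fun i => ?_
  by_cases hi : i = m
  · subst hi; simp only [Function.update_self]; exact le_rfl
  · simp only [Function.update_of_ne hi]; exact huv i

/-! ### §3 Lemma 8.2 for the marginal integrals -/

set_option maxHeartbeats 400000 in
/-- **Lemma 8.2 (ii), marginal form.** For `u, v` in the orthant below a common point `w` with
`u_m = v_m = w_m`: `|∫₀^∞F(v;t_m)dt_m − ∫₀^∞F(u;t_m)dt_m| ≤ (30+30/U_k+T_k)((Σᵢ(wᵢ−uᵢ))∫F₂(u;t_m) + (Σᵢ(wᵢ−vᵢ))∫F₂(v;t_m))`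
(integrate `abs_F_sub_F_le_of_le_of_le` along the common fibre).
[cite: Maynard2016DenseClusters, Lemma 8.2 (ii) p. 15 with proof (8.7)–(8.8); proof of Prop. 9.2 p. 22 («analogously to Lemma 8.2», (9.16))] -/
theorem abs_margInt_F_sub_le (hk : 2 ≤ k) {u v w : Fin k → ℝ} (hu : u ∈ MaynardDense.orthant k)
    (hv : v ∈ MaynardDense.orthant k) (huw : ∀ i, u i ≤ w i) (hvw : ∀ i, v i ≤ w i) (m : Fin k)
    (hum : u m = w m) (hvm : v m = w m) :
    |margInt m (MaynardDense.F k) v - margInt m (MaynardDense.F k) u| ≤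
      (30 + 30 / MaynardDense.U k + MaynardDense.T k) *
        ((∑ i, (w i - u i)) * margInt m (MaynardDense.F₂ k) u +
          (∑ i, (w i - v i)) * margInt m (MaynardDense.F₂ k) v) := by
  set C := 30 + 30 / MaynardDense.U k + MaynardDense.T k with hC
  unfold margInt
  rw [← integral_sub (integrableOn_F_update hk hv m) (integrableOn_F_update hk hu m)]
  have hIu := MaynardDense.integrableOn_F₂_update hk u m
  have hIv := MaynardDense.integrableOn_F₂_update hk v m
  have hbound : ∀ t ∈ Set.Ici (0 : ℝ),
      ‖MaynardDense.F k (Function.update v m t) - MaynardDense.F k (Function.update u m t)‖ ≤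
        C * ((∑ i, (w i - u i)) * MaynardDense.F₂ k (Function.update u m t) +
          (∑ i, (w i - v i)) * MaynardDense.F₂ k (Function.update v m t)) := by
    intro t ht
    rw [Real.norm_eq_abs]
    have hle_u : ∀ i, Function.update u m t i ≤ Function.update w m t i := by
      intro i
      by_cases hi : i = m
      · subst hi; simp only [Function.update_self]; exact le_rfl
      · simp only [Function.update_of_ne hi]; exact huw i
    have hle_v : ∀ i, Function.update v m t i ≤ Function.update w m t i := by
      intro i
      by_cases hi : i = m
      · subst hi; simp only [Function.update_self]; exact le_rfl
      · simp only [Function.update_of_ne hi]; exact hvw i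
    have h := MaynardDense.abs_F_sub_F_le_of_le_of_le hk (MaynardDense.update_mem_orthant hu m ht)
      (MaynardDense.update_mem_orthant hv m ht) hle_u hle_v
    have hsu : ∑ i, (Function.update w m t i - Function.update u m t i) = ∑ i, (w i - u i) := by
      refine Finset.sum_congr rfl fun i _ => ?_
      by_cases hi : i = m
      · subst hi; simp only [Function.update_self, sub_self, hum]
      · simp only [Function.update_of_ne hi]
    have hsv : ∑ i, (Function.update w m t i - Function.update v m t i) = ∑ i, (w i - v i) := by
      refine Finset.sum_congr rfl fun i _ => ?_
      by_cases hi : i = m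
      · subst hi; simp only [Function.update_self, sub_self, hvm]
      · simp only [Function.update_of_ne hi]
    rw [hsu, hsv] at h
    exact h
  have hg : Integrable (fun t => C * ((∑ i, (w i - u i)) * MaynardDense.F₂ k (Function.update u m t) +
      (∑ i, (w i - v i)) * MaynardDense.F₂ k (Function.update v m t)))
      (volume.restrict (Set.Ici 0)) :=
    ((hIu.const_mul _).add (hIv.const_mul _)).const_mul C
  have h1 := norm_integral_le_of_norm_le hg (ae_restrict_of_forall_mem measurableSet_Ici hbound)
  rw [Real.norm_eq_abs] at h1
  refine h1.trans (le_of_eq ?_)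
  rw [integral_const_mul, integral_add (hIu.const_mul _) (hIv.const_mul _), integral_const_mul,
    integral_const_mul]

set_option maxHeartbeats 400000 in
/-- **(9.16), marginal and explicit.** For `r, s ∈ 𝒟'` with `∏rᵢ = ∏sᵢ`:
`|∫F(u(s);t_m) − ∫F(u(r);t_m)| ≤ (30+30/U_k+T_k)·(log A(r,s)/log R)·(∫F₂(u(r);t_m) + ∫F₂(u(s);t_m))`,
`A(r,s)` the product of the mismatched primes (`tᵢ = log[rᵢ,sᵢ]/log R`, `Σᵢ(tᵢ − uᵢ) ≤ log A/log R`).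
[cite: Maynard2016DenseClusters, proof of Prop. 9.2 p. 22, (9.16) («y_s^{(m)} = y_r^{(m)} + O(…(Y_r+Y_s)… log A …)»); Lemma 8.2 (ii)] -/
theorem abs_margInt_sub_margInt_le_logMisProd (hk : 2 ≤ k) {L : Fin k → ℤ × ℤ} {B : ℕ} {R : ℝ}
    (hR : 1 < R) {m : Fin k} {r s : Fin k → ℕ} (hr : r ∈ dkBoxP L B R m) (hs : s ∈ dkBoxP L B R m)
    (heq : (∏ i, r i) = ∏ i, s i) :
    |margInt m (MaynardDense.F k) (logVec R s) - margInt m (MaynardDense.F k) (logVec R r)| ≤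
      (30 + 30 / MaynardDense.U k + MaynardDense.T k) *
        (Real.log (misProd r s (∏ i, r i)) / Real.log R *
          (margInt m (MaynardDense.F₂ k) (logVec R r) + margInt m (MaynardDense.F₂ k) (logVec R s))) := by
  have hrbox := dkBoxP_subset L B R m hr
  have hsbox := dkBoxP_subset L B R m hs
  have hr1 : ∀ i, 1 ≤ r i := one_le_of_mem_dkBox hrbox
  have hs1 : ∀ i, 1 ≤ s i := one_le_of_mem_dkBox hsbox
  have hrm : r m = 1 := ((mem_dkBoxP_iff).1 hr).2.1
  have hsm : s m = 1 := ((mem_dkBoxP_iff).1 hs).2.1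
  have hlogR : 0 < Real.log R := Real.log_pos hR
  have hu : logVec R r ∈ MaynardDense.orthant k := logVec_mem_orthant hR.le r hr1
  have hv : logVec R s ∈ MaynardDense.orthant k := logVec_mem_orthant hR.le s hs1
  set w : Fin k → ℝ := logVec R (fun i => Nat.lcm (r i) (s i)) with hw
  have huw : ∀ i, logVec R r i ≤ w i := by
    intro i
    simp only [hw, logVec]
    exact div_le_div_of_nonneg_right (Real.log_le_log (by exact_mod_cast hr1 i)
      (by exact_mod_cast le_lcm_of_mem_dkBox hrbox hsbox i)) hlogR.le
  have hvw : ∀ i, logVec R s i ≤ w i := by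
    intro i
    simp only [hw, logVec]
    refine div_le_div_of_nonneg_right (Real.log_le_log (by exact_mod_cast hs1 i) ?_) hlogR.le
    rw [Nat.lcm_comm]
    exact_mod_cast le_lcm_of_mem_dkBox hsbox hrbox i
  have hum : logVec R r m = w m := by simp only [hw, logVec, hrm, hsm, Nat.lcm_self]
  have hvm : logVec R s m = w m := by simp only [hw, logVec, hrm, hsm, Nat.lcm_self]
  have h := abs_margInt_F_sub_le hk hu hv huw hvw m hum hvm
  refine h.trans ?_
  have hC : 0 ≤ 30 + 30 / MaynardDense.U k + MaynardDense.T k := by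
    have hU : 0 < MaynardDense.U k := by unfold MaynardDense.U; positivity
    have := MaynardDense.T_pos hk
    positivity
  refine mul_le_mul_of_nonneg_left ?_ hC
  have hI₂r := margInt_F₂_nonneg hk hu m
  have hI₂s := margInt_F₂_nonneg hk hv m
  have hsum_u : ∑ i, (w i - logVec R r i) =
      (∑ i, (Real.log (Nat.lcm (r i) (s i) : ℕ) - Real.log (r i))) / Real.log R := by
    rw [Finset.sum_div]
    refine Finset.sum_congr rfl fun i _ => ?_
    simp only [hw, logVec]; ring
  have hsum_v : ∑ i, (w i - logVec R s i) =
      (∑ i, (Real.log (Nat.lcm (r i) (s i) : ℕ) - Real.log (s i))) / Real.log R := by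
    rw [Finset.sum_div]
    refine Finset.sum_congr rfl fun i _ => ?_
    simp only [hw, logVec]; ring
  have h1 := sum_log_lcm_sub_log_le hrbox hsbox heq
  have h2 := sum_log_lcm_sub_log_le hsbox hrbox heq.symm
  rw [← heq, misProd_comm s r] at h2
  have h2' : ∑ i, (Real.log (Nat.lcm (r i) (s i) : ℕ) - Real.log (s i)) ≤
      Real.log (misProd r s (∏ i, r i)) :=
    le_trans (le_of_eq (Finset.sum_congr rfl fun i _ => by rw [Nat.lcm_comm])) h2
  rw [hsum_u, hsum_v, mul_add]
  exact add_le_add (mul_le_mul_of_nonneg_right (div_le_div_of_nonneg_right h1 hlogR.le) hI₂r)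
    (mul_le_mul_of_nonneg_right (div_le_div_of_nonneg_right h2' hlogR.le) hI₂s)

/-! ### §4 The pointwise bound with the Lemma-9.3 approximation, and symmetrisation -/

/-- The second symmetric kernel `[∏s = ∏r]·∏_{p∣(r,s)}(p−1)/φ_ω(∏r)²` (carrying the `δ`-terms of Lemma 9.3).
[cite: Maynard2016DenseClusters, proof of Prop. 9.2 p. 22, (9.14)–(9.15) with Lemma 9.3 (error term)] -/
def matchKernel (L : Fin k → ℤ × ℤ) (r s : Fin k → ℕ) : ℝ :=
  if (∏ i, s i) = ∏ i, r i then matchWt r s (∏ i, r i) / phiOmega L (∏ i, r i) ^ 2 else 0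

/-- `matchKernel` is symmetric. [cite: Maynard2016DenseClusters, proof of Prop. 9.2 p. 22 (T^{(m)} symmetric)] -/
theorem matchKernel_comm (L : Fin k → ℤ × ℤ) (r s : Fin k → ℕ) :
    matchKernel L s r = matchKernel L r s := by
  unfold matchKernel
  by_cases h : (∏ i, s i) = ∏ i, r i
  · rw [if_pos h.symm, if_pos h, h, matchWt_comm s r]
  · rw [if_neg (Ne.symm h), if_neg h]

/-- `matchKernel ≥ 0`. [cite: Maynard2016DenseClusters, proof of Prop. 9.2 p. 22] -/
theorem matchKernel_nonneg (L : Fin k → ℤ × ℤ) (r s : Fin k → ℕ) : 0 ≤ matchKernel L r s := by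
  unfold matchKernel
  split_ifs
  · exact div_nonneg (matchWt_nonneg r s _) (sq_nonneg _)
  · exact le_rfl

set_option maxHeartbeats 400000 in
/-- **Pointwise bound on the `E_diff^{(m)}` summand, kernel form.** If `|y_r − c I(r)| ≤ δ c I₂(r)` on `𝒟'`
(Lemma 9.3; `I = ∫F dt_m`, `I₂ = ∫F₂ dt_m`), then for `r, s ∈ 𝒟'`
`|y_r (y_s − y_r) T^{(m)}(r,s)/φ_ω(∏r)²| ≤ c²(1/k + δ)·((30+30/U_k+T_k)/log R · g(r,s) + δ·g₀(r,s))·(3/2 I₂(r)² + 1/2 I₂(s)²)`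
with the Prop-9.1 kernel `g` (`ediffKernel`) and `g₀ = matchKernel`.
[cite: Maynard2016DenseClusters, proof of Prop. 9.2 p. 22, (9.16) («y_r y_s ≪ …», «Y_rY_s ≤ Y_r² + Y_s²»); Lemma 9.3; Lemma 8.2 (ii)] -/
theorem abs_ediffM_summand_le_kernel {L : Fin k → ℤ × ℤ} (hadm : FormsAdmissible L) (hk : 2 ≤ k)
    {B : ℕ} {R : ℝ} (hR : 1 < R) {m : Fin k} {c δ : ℝ} (hc : 0 ≤ c) (hδ : 0 ≤ δ)
    (happrox : ∀ r ∈ dkBoxP L B R m,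
      |yVarM L B R (MaynardDense.F k) m r - c * margInt m (MaynardDense.F k) (logVec R r)| ≤
        δ * c * margInt m (MaynardDense.F₂ k) (logVec R r))
    {r s : Fin k → ℕ} (hr : r ∈ dkBoxP L B R m) (hs : s ∈ dkBoxP L B R m) :
    |yVarM L B R (MaynardDense.F k) m r *
          (yVarM L B R (MaynardDense.F k) m s - yVarM L B R (MaynardDense.F k) m r) /
        phiOmega L (∏ i, r i) ^ 2 * localPairSumM L B R m r s| ≤
      c ^ 2 * (1 / k + δ) *
        (((30 + 30 / MaynardDense.U k + MaynardDense.T k) / Real.log R * ediffKernel L r s +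
            δ * matchKernel L r s) *
          (3 / 2 * margInt m (MaynardDense.F₂ k) (logVec R r) ^ 2 +
            1 / 2 * margInt m (MaynardDense.F₂ k) (logVec R s) ^ 2)) := by
  have hl : (L m).1 ≠ 0 := hadm.1 m
  have hrbox := dkBoxP_subset L B R m hr
  have hsbox := dkBoxP_subset L B R m hs
  have hr1 : ∀ i, 1 ≤ r i := one_le_of_mem_dkBox hrbox
  have hs1 : ∀ i, 1 ≤ s i := one_le_of_mem_dkBox hsbox
  have hlogR : 0 < Real.log R := Real.log_pos hR
  have hk0 : (0 : ℝ) < k := by exact_mod_cast lt_of_lt_of_le (by norm_num) hk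
  have hu : logVec R r ∈ MaynardDense.orthant k := logVec_mem_orthant hR.le r hr1
  have hv : logVec R s ∈ MaynardDense.orthant k := logVec_mem_orthant hR.le s hs1
  set C := 30 + 30 / MaynardDense.U k + MaynardDense.T k with hC
  have hC0 : 0 ≤ C := by
    have hU : 0 < MaynardDense.U k := by unfold MaynardDense.U; positivity
    have := MaynardDense.T_pos hk
    positivity
  set Ir := margInt m (MaynardDense.F k) (logVec R r) with hIr
  set Is := margInt m (MaynardDense.F k) (logVec R s) with hIs
  set I₂r := margInt m (MaynardDense.F₂ k) (logVec R r) with hI₂r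
  set I₂s := margInt m (MaynardDense.F₂ k) (logVec R s) with hI₂s
  set yr := yVarM L B R (MaynardDense.F k) m r with hyr
  set ys := yVarM L B R (MaynardDense.F k) m s with hys
  have hIr0 : 0 ≤ Ir := margInt_F_nonneg hk hu m
  have hI₂r0 : 0 ≤ I₂r := margInt_F₂_nonneg hk hu m
  have hI₂s0 : 0 ≤ I₂s := margInt_F₂_nonneg hk hv m
  have hIrle : Ir ≤ I₂r / k := by
    rw [le_div_iff₀ hk0, mul_comm]; exact mul_margInt_F_le_margInt_F₂ hk hu m
  have hIsle : Is ≤ I₂s / k := by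
    rw [le_div_iff₀ hk0, mul_comm]; exact mul_margInt_F_le_margInt_F₂ hk hv m
  have har := happrox r hr
  have has := happrox s hs
  -- `|y_r| ≤ c (1/k + δ) I₂(r)`
  have hyr_le : |yr| ≤ c * (1 / k + δ) * I₂r := by
    have h1 : |yr| ≤ |yr - c * Ir| + c * Ir := by
      have := abs_add_le (yr - c * Ir) (c * Ir)
      rw [sub_add_cancel] at this
      rw [abs_of_nonneg (mul_nonneg hc hIr0)] at this
      exact this
    have h2 : c * Ir ≤ c * (I₂r / k) := mul_le_mul_of_nonneg_left hIrle hc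
    have h3 : c * (1 / k + δ) * I₂r = δ * c * I₂r + c * (I₂r / k) := by ring
    rw [h3]; linarith
  by_cases heq : (∏ i, r i) = ∏ i, s i
  · have hφ : 0 < phiOmega L (∏ i, r i) := phiOmega_prod_pos_of_mem_dkBox hadm hrbox
    set lA := Real.log (misProd r s (∏ i, r i)) with hlA
    set M := matchWt r s (∏ i, r i) with hM
    have hlA0 : 0 ≤ lA := Real.log_nonneg (by exact_mod_cast one_le_misProd r s _)
    have hM0 : 0 ≤ M := matchWt_nonneg r s _
    -- `|y_s − y_r| ≤ c (C lA/log R + δ)(I₂(r) + I₂(s))`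
    have hd : |ys - yr| ≤ c * (C * (lA / Real.log R) + δ) * (I₂r + I₂s) := by
      have h82 := abs_margInt_sub_margInt_le_logMisProd hk hR hr hs heq
      have htri : |ys - yr| ≤ |ys - c * Is| + c * |Is - Ir| + |c * Ir - yr| := by
        have e : ys - yr = (ys - c * Is) + c * (Is - Ir) + (c * Ir - yr) := by ring
        rw [e]
        refine (abs_add_le _ _).trans (add_le_add ((abs_add_le _ _).trans (add_le_add le_rfl ?_)) le_rfl)
        rw [abs_mul, abs_of_nonneg hc]
      have h3 : |c * Ir - yr| ≤ δ * c * I₂r := by rw [abs_sub_comm]; exact har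
      have h4 : c * |Is - Ir| ≤ c * (C * (lA / Real.log R * (I₂r + I₂s))) :=
        mul_le_mul_of_nonneg_left h82 hc
      have e2 : c * (C * (lA / Real.log R) + δ) * (I₂r + I₂s) =
          δ * c * I₂s + c * (C * (lA / Real.log R * (I₂r + I₂s))) + δ * c * I₂r := by ring
      rw [e2]; linarith
    have hT := abs_localPairSumM_le_matchWt hl hr hs heq
    rw [mul_comm _ (localPairSumM L B R m r s), ← mul_div_assoc, mul_comm (localPairSumM L B R m r s),
      abs_div, abs_of_pos (pow_pos hφ 2), div_le_iff₀ (pow_pos hφ 2), abs_mul, abs_mul]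
    have hker : (C / Real.log R * ediffKernel L r s + δ * matchKernel L r s) * phiOmega L (∏ i, r i) ^ 2 =
        (C * (lA / Real.log R) + δ) * M := by
      unfold ediffKernel matchKernel
      rw [if_pos heq.symm, if_pos heq.symm, hlA, hM]
      field_simp
    have hsq : I₂r * (I₂r + I₂s) ≤ 3 / 2 * I₂r ^ 2 + 1 / 2 * I₂s ^ 2 := by
      nlinarith [sq_nonneg (I₂r - I₂s)]
    have hcoef0 : 0 ≤ c * (C * (lA / Real.log R) + δ) := by positivity
    calc |yr| * |ys - yr| * |localPairSumM L B R m r s|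
        ≤ (c * (1 / k + δ) * I₂r) * (c * (C * (lA / Real.log R) + δ) * (I₂r + I₂s)) * M := by
          refine mul_le_mul (mul_le_mul hyr_le hd (abs_nonneg _) (by positivity)) hT (abs_nonneg _) ?_
          positivity
      _ = c ^ 2 * (1 / k + δ) * ((C * (lA / Real.log R) + δ) * M) * (I₂r * (I₂r + I₂s)) := by ring
      _ ≤ c ^ 2 * (1 / k + δ) * ((C * (lA / Real.log R) + δ) * M) * (3 / 2 * I₂r ^ 2 + 1 / 2 * I₂s ^ 2) :=
          mul_le_mul_of_nonneg_left hsq (by positivity)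
      _ = c ^ 2 * (1 / k + δ) * ((C / Real.log R * ediffKernel L r s + δ * matchKernel L r s) *
            (3 / 2 * I₂r ^ 2 + 1 / 2 * I₂s ^ 2)) * phiOmega L (∏ i, r i) ^ 2 := by
          rw [← hker]; ring
  · rw [localPairSumM_eq_zero_of_prod_ne hl hr hs heq, mul_zero, abs_zero]
    have hk' : 0 ≤ ediffKernel L r s := ediffKernel_nonneg L r s
    have hm' : 0 ≤ matchKernel L r s := matchKernel_nonneg L r s
    positivity

set_option maxHeartbeats 400000 in
/-- **`E_diff^{(m)}` after symmetrisation** (both kernels are symmetric, `φ_ω(∏r) = φ_ω(∏s)` on the support):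
`|E_diff^{(m)}| ≤ 2c²(1/k+δ)·((30+30/U_k+T_k)/log R · Σ_{r∈𝒟'} I₂(r)²/φ_ω(∏r)² Σ_{s∈𝒟', ∏s=∏r} log A·∏_{p∣(r,s)}(p−1)
 + δ · Σ_{r∈𝒟'} I₂(r)²/φ_ω(∏r)² Σ_{s∈𝒟', ∏s=∏r} ∏_{p∣(r,s)}(p−1))`.
[cite: Maynard2016DenseClusters, proof of Prop. 9.2 p. 22, (9.16)–(9.18); proof of Prop. 9.1 pp. 19–20] -/
theorem abs_ediffM_le_sum_kernels {L : Fin k → ℤ × ℤ} (hadm : FormsAdmissible L) (hk : 2 ≤ k)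
    {B : ℕ} {R : ℝ} (hR : 1 < R) (m : Fin k) {c δ : ℝ} (hc : 0 ≤ c) (hδ : 0 ≤ δ)
    (happrox : ∀ r ∈ dkBoxP L B R m,
      |yVarM L B R (MaynardDense.F k) m r - c * margInt m (MaynardDense.F k) (logVec R r)| ≤
        δ * c * margInt m (MaynardDense.F₂ k) (logVec R r)) :
    |ediffM L B R (MaynardDense.F k) m| ≤
      2 * (c ^ 2 * (1 / k + δ)) *
        ((30 + 30 / MaynardDense.U k + MaynardDense.T k) / Real.log R *
            ∑ r ∈ dkBoxP L B R m, margInt m (MaynardDense.F₂ k) (logVec R r) ^ 2 /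
                phiOmega L (∏ i, r i) ^ 2 *
              ∑ s ∈ (dkBoxP L B R m).filter (fun s => (∏ i, s i) = ∏ i, r i),
                Real.log (misProd r s (∏ i, r i)) * matchWt r s (∏ i, r i) +
          δ * ∑ r ∈ dkBoxP L B R m, margInt m (MaynardDense.F₂ k) (logVec R r) ^ 2 /
                phiOmega L (∏ i, r i) ^ 2 *
              ∑ s ∈ (dkBoxP L B R m).filter (fun s => (∏ i, s i) = ∏ i, r i),
                matchWt r s (∏ i, r i)) := by
  classical
  set D := dkBoxP L B R m with hD
  set C₀ := c ^ 2 * (1 / k + δ) with hC₀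
  set C₁ := (30 + 30 / MaynardDense.U k + MaynardDense.T k) / Real.log R with hC₁
  set Fq : (Fin k → ℕ) → ℝ := fun r => margInt m (MaynardDense.F₂ k) (logVec R r) ^ 2 with hFq
  set K : (Fin k → ℕ) → (Fin k → ℕ) → ℝ := fun r s => C₁ * ediffKernel L r s + δ * matchKernel L r s
    with hK
  have hKcomm : ∀ r s, K s r = K r s := by
    intro r s; simp only [hK, ediffKernel_comm L r s, matchKernel_comm L r s]
  have hpt : ∀ r ∈ D, ∀ s ∈ D,
      |yVarM L B R (MaynardDense.F k) m r *
            (yVarM L B R (MaynardDense.F k) m s - yVarM L B R (MaynardDense.F k) m r) /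
          phiOmega L (∏ i, r i) ^ 2 * localPairSumM L B R m r s| ≤
        C₀ * (K r s * (3 / 2 * Fq r + 1 / 2 * Fq s)) :=
    fun r hr s hs => abs_ediffM_summand_le_kernel hadm hk hR hc hδ happrox hr hs
  have h1 : |ediffM L B R (MaynardDense.F k) m| ≤
      ∑ r ∈ D, ∑ s ∈ D, C₀ * (K r s * (3 / 2 * Fq r + 1 / 2 * Fq s)) := by
    unfold ediffM
    refine (Finset.abs_sum_le_sum_abs _ _).trans (Finset.sum_le_sum fun r hr => ?_)
    exact (Finset.abs_sum_le_sum_abs _ _).trans (Finset.sum_le_sum fun s hs => hpt r hr s hs)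
  refine h1.trans (le_of_eq ?_)
  have hswap : ∑ r ∈ D, ∑ s ∈ D, K r s * Fq s = ∑ r ∈ D, ∑ s ∈ D, K r s * Fq r := by
    rw [Finset.sum_comm]
    refine Finset.sum_congr rfl fun s _ => Finset.sum_congr rfl fun r _ => ?_
    rw [hKcomm]
  have hlhs : ∑ r ∈ D, ∑ s ∈ D, C₀ * (K r s * (3 / 2 * Fq r + 1 / 2 * Fq s)) =
      C₀ * (3 / 2 * ∑ r ∈ D, ∑ s ∈ D, K r s * Fq r + 1 / 2 * ∑ r ∈ D, ∑ s ∈ D, K r s * Fq s) := by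
    rw [Finset.mul_sum, Finset.mul_sum, ← Finset.sum_add_distrib, Finset.mul_sum]
    refine Finset.sum_congr rfl fun r _ => ?_
    rw [Finset.mul_sum, Finset.mul_sum, ← Finset.sum_add_distrib, Finset.mul_sum]
    refine Finset.sum_congr rfl fun s _ => ?_
    ring
  rw [hlhs, hswap]
  have hinner : ∀ r ∈ D, ∑ s ∈ D, K r s * Fq r =
      C₁ * (Fq r / phiOmega L (∏ i, r i) ^ 2 *
        ∑ s ∈ D.filter (fun s => (∏ i, s i) = ∏ i, r i),
          Real.log (misProd r s (∏ i, r i)) * matchWt r s (∏ i, r i)) +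
      δ * (Fq r / phiOmega L (∏ i, r i) ^ 2 *
        ∑ s ∈ D.filter (fun s => (∏ i, s i) = ∏ i, r i), matchWt r s (∏ i, r i)) := by
    intro r hr
    rw [Finset.sum_filter, Finset.sum_filter, Finset.mul_sum, Finset.mul_sum, Finset.mul_sum,
      Finset.mul_sum, ← Finset.sum_add_distrib]
    refine Finset.sum_congr rfl fun s _ => ?_
    simp only [hK]
    unfold ediffKernel matchKernel
    split_ifs
    · ring
    · simp
  rw [Finset.sum_congr rfl hinner, Finset.sum_add_distrib, ← Finset.mul_sum, ← Finset.mul_sum]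
  ring

/-! ### §5 Counting the `s` and regrouping `r = p·r'` -/

set_option maxHeartbeats 400000 in
/-- **Removing `p` from `rⱼ` over `𝒟'`**: for a weight `Φ ≥ 0` that does not decrease when a prime is removed
from a coordinate, `Σ_{r ∈ 𝒟', p∣rⱼ} Φ(r) w(∏r/p) ≤ Σ_{r' ∈ 𝒟'} Φ(r') w(∏r')` (`r ↦ r/p@j` injects `𝒟'` into `𝒟'`).
[cite: Maynard2016DenseClusters, proof of Prop. 9.2 p. 22 («letting r = A r'», (9.18)); proof of Prop. 9.1 p. 20] -/
theorem sum_filter_dvd_wRatio_le_dkBoxP (hk : 1 ≤ k) {L : Fin k → ℤ × ℤ} {B : ℕ} {R : ℝ} {m : Fin k}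
    {Φ : (Fin k → ℕ) → ℝ} (hΦ0 : ∀ r, 0 ≤ Φ r)
    (hΦ : ∀ r ∈ dkBoxP L B R m, ∀ (j : Fin k) (p : ℕ), p.Prime → p ∣ r j →
      Φ r ≤ Φ (Function.update r j (r j / p)))
    {p : ℕ} (hp : p.Prime) (j : Fin k) :
    ∑ r ∈ (dkBoxP L B R m).filter (fun r => p ∣ r j), Φ r * wRatio L ((∏ i, r i) / p) ≤
      ∑ r ∈ dkBoxP L B R m, Φ r * wRatio L (∏ i, r i) := by
  classical
  set φ : (Fin k → ℕ) → (Fin k → ℕ) := fun r => Function.update r j (r j / p) with hφ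
  set g : (Fin k → ℕ) → ℝ := fun r => Φ r * wRatio L (∏ i, r i) with hg
  have hpt : ∀ r ∈ (dkBoxP L B R m).filter (fun r => p ∣ r j),
      Φ r * wRatio L ((∏ i, r i) / p) ≤ g (φ r) := by
    intro r hr
    obtain ⟨hrP, hpj⟩ := Finset.mem_filter.1 hr
    have hprod : (∏ i, φ r i) = (∏ i, r i) / p :=
      (Nat.div_eq_of_eq_mul_right hp.pos (by rw [mul_prod_update_div r j hpj])).symm
    simp only [hg]
    rw [hprod]
    exact mul_le_mul_of_nonneg_right (hΦ r hrP j p hp hpj) (wRatio_nonneg hk L _)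
  have hinj : ∀ r ∈ (dkBoxP L B R m).filter (fun r => p ∣ r j),
      ∀ t ∈ (dkBoxP L B R m).filter (fun r => p ∣ r j), φ r = φ t → r = t := by
    intro r hr t ht hrt
    have hpr := (Finset.mem_filter.1 hr).2
    have hpt' := (Finset.mem_filter.1 ht).2
    have h1 : r = Function.update (φ r) j (φ r j * p) := by
      simp only [hφ]
      rw [Function.update_idem, Function.update_self, Nat.div_mul_cancel hpr, Function.update_eq_self]
    have h2 : t = Function.update (φ t) j (φ t j * p) := by
      simp only [hφ]
      rw [Function.update_idem, Function.update_self, Nat.div_mul_cancel hpt', Function.update_eq_self]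
    rw [h1, h2, hrt]
  have himg : ((dkBoxP L B R m).filter (fun r => p ∣ r j)).image φ ⊆ dkBoxP L B R m := by
    intro r' hr'
    obtain ⟨r, hr, rfl⟩ := Finset.mem_image.1 hr'
    obtain ⟨hrP, hpj⟩ := Finset.mem_filter.1 hr
    exact update_div_mem_dkBoxP hrP j hpj
  calc ∑ r ∈ (dkBoxP L B R m).filter (fun r => p ∣ r j), Φ r * wRatio L ((∏ i, r i) / p)
      ≤ ∑ r ∈ (dkBoxP L B R m).filter (fun r => p ∣ r j), g (φ r) := Finset.sum_le_sum hpt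
    _ = ∑ r' ∈ ((dkBoxP L B R m).filter (fun r => p ∣ r j)).image φ, g r' :=
        (Finset.sum_image hinj).symm
    _ ≤ ∑ r' ∈ dkBoxP L B R m, g r' :=
        Finset.sum_le_sum_of_subset_of_nonneg himg fun r' _ _ =>
          mul_nonneg (hΦ0 r') (wRatio_nonneg hk L _)

set_option maxHeartbeats 400000 in
/-- **The regrouped bound over `𝒟'`** (the `(log A)`-twisted count (9.17)–(9.18)): for `Φ ≥ 0` non-decreasing
under removing primes, `Σ_{r∈𝒟'} Φ(r)/φ_ω(∏r)² Σ_{s∈𝒟', ∏s=∏r} log A(r,s) ∏_{p∣(r,s)}(p−1) ≤ 6 log 4 · Σ_{r∈𝒟'} Φ(r) w(∏r)`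
— count over the larger `𝒟_k` (`sum_log_misProd_mul_matchWt_le`), regroup by the mismatched prime, `(p − ω(p))² ≥ p²/4`,
Chebyshev tail `Σ_{p>2k²} log p/p² ≤ 3 log 4/(2k²)`.
[cite: Maynard2016DenseClusters, proof of Prop. 9.2 p. 22, (9.17)–(9.18) («Σ_A (log A) ω(A)/φ_ω(A)² Σ_{r'} Y_{r'}² φ(r')/φ_ω(r')²»); proof of Prop. 9.1 p. 20] -/
theorem sum_kernel_le_dkBoxP (hk : 2 ≤ k) {L : Fin k → ℤ × ℤ} (hadm : FormsAdmissible L) {B : ℕ}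
    {R : ℝ} {m : Fin k} {Φ : (Fin k → ℕ) → ℝ} (hΦ0 : ∀ r, 0 ≤ Φ r)
    (hΦ : ∀ r ∈ dkBoxP L B R m, ∀ (j : Fin k) (p : ℕ), p.Prime → p ∣ r j →
      Φ r ≤ Φ (Function.update r j (r j / p))) :
    ∑ r ∈ dkBoxP L B R m, Φ r / phiOmega L (∏ i, r i) ^ 2 *
        ∑ s ∈ (dkBoxP L B R m).filter (fun s => (∏ i, s i) = ∏ i, r i),
          Real.log (misProd r s (∏ i, r i)) * matchWt r s (∏ i, r i) ≤
      6 * Real.log 4 * ∑ r ∈ dkBoxP L B R m, Φ r * wRatio L (∏ i, r i) := by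
  classical
  have hk1 : 1 ≤ k := le_trans (by norm_num) hk
  set D := dkBoxP L B R m with hD
  set Sw := ∑ r ∈ D, Φ r * wRatio L (∏ i, r i) with hSw
  have hSw0 : 0 ≤ Sw := Finset.sum_nonneg fun r _ => mul_nonneg (hΦ0 r) (wRatio_nonneg hk1 L _)
  -- (1) per `r`: count (over the larger box `𝒟_k`) and peel the weight
  have hper : ∀ r ∈ D, Φ r / phiOmega L (∏ i, r i) ^ 2 *
      ∑ s ∈ D.filter (fun s => (∏ i, s i) = ∏ i, r i),
        Real.log (misProd r s (∏ i, r i)) * matchWt r s (∏ i, r i) ≤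
      ((k : ℝ) - 1) * ∑ p ∈ (∏ i, r i).primeFactors,
        Real.log p / ((p : ℝ) - omegaL L p) ^ 2 * (Φ r * wRatio L ((∏ i, r i) / p)) := by
    intro r hr
    have hrbox : r ∈ dkBox L B R := dkBoxP_subset L B R m hr
    have hsq : Squarefree (∏ i, r i) := squarefree_of_mem_dkBox hrbox
    have hφ : 0 < phiOmega L (∏ i, r i) := phiOmega_prod_pos_of_mem_dkBox hadm hrbox
    have hcount' := sum_log_misProd_mul_matchWt_le hk1 hrbox rfl
    have hsub : ∑ s ∈ D.filter (fun s => (∏ i, s i) = ∏ i, r i),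
        Real.log (misProd r s (∏ i, r i)) * matchWt r s (∏ i, r i) ≤
        ∑ s ∈ (dkBox L B R).filter (fun s => (∏ i, s i) = ∏ i, r i),
          Real.log (misProd r s (∏ i, r i)) * matchWt r s (∏ i, r i) := by
      refine Finset.sum_le_sum_of_subset_of_nonneg (fun s hs => ?_) fun s _ _ =>
        mul_nonneg (Real.log_nonneg (by exact_mod_cast one_le_misProd r s _)) (matchWt_nonneg r s _)
      obtain ⟨hsD, hse⟩ := Finset.mem_filter.1 hs
      exact Finset.mem_filter.2 ⟨dkBoxP_subset L B R m hsD, hse⟩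
    have hcount := hsub.trans hcount'
    have hFq0 : 0 ≤ Φ r / phiOmega L (∏ i, r i) ^ 2 := div_nonneg (hΦ0 r) (sq_nonneg _)
    refine (mul_le_mul_of_nonneg_left hcount hFq0).trans (le_of_eq ?_)
    rw [Finset.mul_sum, Finset.mul_sum, Finset.mul_sum]
    refine Finset.sum_congr rfl fun p hp => ?_
    have hpp := Nat.prime_of_mem_primeFactors hp
    have hpeel := prod_erase_div_phiOmega_sq L hsq hpp (Nat.dvd_of_mem_primeFactors hp)
    calc Φ r / phiOmega L (∏ i, r i) ^ 2 * (((k : ℝ) - 1) *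
          (Real.log p * ∏ q ∈ (∏ i, r i).primeFactors.erase p, ((q : ℝ) + k - 2)))
        = ((k : ℝ) - 1) * (Real.log p * Φ r *
          ((∏ q ∈ (∏ i, r i).primeFactors.erase p, ((q : ℝ) + k - 2)) / phiOmega L (∏ i, r i) ^ 2)) := by
          ring
      _ = ((k : ℝ) - 1) * (Real.log p / ((p : ℝ) - omegaL L p) ^ 2 * (Φ r * wRatio L ((∏ i, r i) / p))) := by
          rw [hpeel]; ring
  -- (2) swap `Σ_r Σ_{p ∣ ∏r}` into `Σ_{p} Σ_{r : p ∣ ∏r}`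
  have hswap : ∑ r ∈ D, ∑ p ∈ (∏ i, r i).primeFactors,
      Real.log p / ((p : ℝ) - omegaL L p) ^ 2 * (Φ r * wRatio L ((∏ i, r i) / p)) =
      ∑ p ∈ dkPrimes k R, ∑ r ∈ D.filter (fun r => p ∈ (∏ i, r i).primeFactors),
        Real.log p / ((p : ℝ) - omegaL L p) ^ 2 * (Φ r * wRatio L ((∏ i, r i) / p)) := by
    refine Finset.sum_comm' fun r p => ?_
    rw [Finset.mem_filter]
    constructor
    · rintro ⟨hr, hp⟩
      exact ⟨⟨hr, hp⟩, mem_dkPrimes_of_mem_primeFactors (dkBoxP_subset L B R m hr) hp⟩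
    · rintro ⟨⟨hr, hp⟩, -⟩
      exact ⟨hr, hp⟩
  -- (3) for fixed `p`: at most `k` positions, each fibre injects into `𝒟'`
  have hfib : ∀ p ∈ dkPrimes k R,
      ∑ r ∈ D.filter (fun r => p ∈ (∏ i, r i).primeFactors), Φ r * wRatio L ((∏ i, r i) / p) ≤
        k * Sw := by
    intro p hp
    have hpp : p.Prime := (Finset.mem_filter.1 hp).2.1
    have hnn : ∀ r, 0 ≤ Φ r * wRatio L ((∏ i, r i) / p) := fun r =>
      mul_nonneg (hΦ0 r) (wRatio_nonneg hk1 L _)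
    have hone : ∀ r ∈ D.filter (fun r => p ∈ (∏ i, r i).primeFactors),
        Φ r * wRatio L ((∏ i, r i) / p) ≤
          ∑ j : Fin k, (if p ∣ r j then Φ r * wRatio L ((∏ i, r i) / p) else 0) := by
      intro r hr
      obtain ⟨-, hpmem⟩ := Finset.mem_filter.1 hr
      obtain ⟨j₀, -, hj₀⟩ := ((Nat.prime_iff.1 hpp).dvd_finsetProd_iff _).1
        (Nat.dvd_of_mem_primeFactors hpmem)
      refine le_trans (le_of_eq (by rw [if_pos hj₀])) (Finset.single_le_sum (f := fun j =>
        if p ∣ r j then Φ r * wRatio L ((∏ i, r i) / p) else 0) (fun j _ => ?_) (Finset.mem_univ j₀))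
      split_ifs
      · exact hnn r
      · exact le_rfl
    calc ∑ r ∈ D.filter (fun r => p ∈ (∏ i, r i).primeFactors), Φ r * wRatio L ((∏ i, r i) / p)
        ≤ ∑ r ∈ D.filter (fun r => p ∈ (∏ i, r i).primeFactors),
            ∑ j : Fin k, (if p ∣ r j then Φ r * wRatio L ((∏ i, r i) / p) else 0) :=
          Finset.sum_le_sum hone
      _ = ∑ j : Fin k, ∑ r ∈ D.filter (fun r => p ∈ (∏ i, r i).primeFactors),
            (if p ∣ r j then Φ r * wRatio L ((∏ i, r i) / p) else 0) := Finset.sum_comm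
      _ ≤ ∑ j : Fin k, ∑ r ∈ D.filter (fun r => p ∣ r j), Φ r * wRatio L ((∏ i, r i) / p) := by
          refine Finset.sum_le_sum fun j _ => ?_
          rw [← Finset.sum_filter]
          refine Finset.sum_le_sum_of_subset_of_nonneg (fun r hr => ?_) fun r _ _ => hnn r
          obtain ⟨hr1, hpj⟩ := Finset.mem_filter.1 hr
          exact Finset.mem_filter.2 ⟨(Finset.mem_filter.1 hr1).1, hpj⟩
      _ ≤ ∑ j : Fin k, Sw := Finset.sum_le_sum fun j _ =>
          sum_filter_dvd_wRatio_le_dkBoxP hk1 hΦ0 hΦ hpp j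
      _ = k * Sw := by rw [Finset.sum_const, Finset.card_univ, Fintype.card_fin, nsmul_eq_mul]
  -- (4) the prime tail
  have htail : ∑ p ∈ dkPrimes k R, Real.log p / (p : ℝ) ^ 2 ≤ 3 * Real.log 4 / (2 * k ^ 2 : ℕ) := by
    have h2 : 2 ≤ 2 * k ^ 2 := by nlinarith
    exact MaynardDense.sum_filter_prime_gt_log_div_sq_le h2 (Finset.Icc 1 ⌊R⌋₊)
  have hk0 : (0 : ℝ) < k := by exact_mod_cast lt_of_lt_of_le (by norm_num) hk
  have hkm1 : (0 : ℝ) ≤ (k : ℝ) - 1 := by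
    have : (1 : ℝ) ≤ k := by exact_mod_cast hk1
    linarith
  -- assemble
  calc ∑ r ∈ D, Φ r / phiOmega L (∏ i, r i) ^ 2 *
        ∑ s ∈ D.filter (fun s => (∏ i, s i) = ∏ i, r i),
          Real.log (misProd r s (∏ i, r i)) * matchWt r s (∏ i, r i)
      ≤ ∑ r ∈ D, ((k : ℝ) - 1) * ∑ p ∈ (∏ i, r i).primeFactors,
          Real.log p / ((p : ℝ) - omegaL L p) ^ 2 * (Φ r * wRatio L ((∏ i, r i) / p)) :=
        Finset.sum_le_sum hper
    _ = ((k : ℝ) - 1) * ∑ p ∈ dkPrimes k R, ∑ r ∈ D.filter (fun r => p ∈ (∏ i, r i).primeFactors),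
          Real.log p / ((p : ℝ) - omegaL L p) ^ 2 * (Φ r * wRatio L ((∏ i, r i) / p)) := by
        rw [← Finset.mul_sum, hswap]
    _ = ((k : ℝ) - 1) * ∑ p ∈ dkPrimes k R, Real.log p / ((p : ℝ) - omegaL L p) ^ 2 *
          ∑ r ∈ D.filter (fun r => p ∈ (∏ i, r i).primeFactors), Φ r * wRatio L ((∏ i, r i) / p) := by
        congr 1
        refine Finset.sum_congr rfl fun p _ => ?_
        rw [Finset.mul_sum]
    _ ≤ ((k : ℝ) - 1) * ∑ p ∈ dkPrimes k R, (4 * (Real.log p / (p : ℝ) ^ 2)) * (k * Sw) := by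
        refine mul_le_mul_of_nonneg_left (Finset.sum_le_sum fun p hp => ?_) hkm1
        have hlp : 0 ≤ Real.log p / ((p : ℝ) - omegaL L p) ^ 2 :=
          div_nonneg (Real.log_nonneg (by exact_mod_cast (Finset.mem_filter.1 hp).2.1.one_lt.le))
            (sq_nonneg _)
        exact mul_le_mul (log_div_sub_omegaL_sq_le hadm hk1 hp) (hfib p hp)
          (Finset.sum_nonneg fun r _ => mul_nonneg (hΦ0 r) (wRatio_nonneg hk1 L _))
          (by positivity)
    _ = 4 * ((k : ℝ) - 1) * k * Sw * ∑ p ∈ dkPrimes k R, Real.log p / (p : ℝ) ^ 2 := by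
        rw [← Finset.sum_mul, ← Finset.mul_sum]; ring
    _ ≤ 4 * ((k : ℝ) - 1) * k * Sw * (3 * Real.log 4 / (2 * k ^ 2 : ℕ)) :=
        mul_le_mul_of_nonneg_left htail (by positivity)
    _ ≤ 6 * Real.log 4 * Sw := by
        have hlog4 : 0 < Real.log 4 := Real.log_pos (by norm_num)
        push_cast
        have h1 : 4 * ((k : ℝ) - 1) * k * Sw * (3 * Real.log 4 / (2 * (k : ℝ) ^ 2)) =
            6 * Real.log 4 * Sw * (((k : ℝ) - 1) / k) := by
          field_simp
          ring
        rw [h1]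
        have h2 : ((k : ℝ) - 1) / k ≤ 1 := by
          rw [div_le_one hk0]; linarith
        calc 6 * Real.log 4 * Sw * (((k : ℝ) - 1) / k) ≤ 6 * Real.log 4 * Sw * 1 :=
              mul_le_mul_of_nonneg_left h2 (by positivity)
          _ = 6 * Real.log 4 * Sw := mul_one _

/-- **The total count**: `Σ_{s ∈ 𝒟', ∏s = ∏r} ∏_{p∣(r,s)}(p−1) ≤ ∏_{q∣∏r}(q+k−2)` — every prime of `∏r` sits in `s`
either at its own position (weight `q − 1`) or at one of `≤ k − 1` others (weight `1`); Maynard's exact value is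
(9.15) `φ_ω`. [cite: Maynard2016DenseClusters, proof of Prop. 9.2 p. 22, (9.15) and the count above it; proof of Prop. 9.1 p. 19] -/
theorem sum_filter_matchWt_le_dkBoxP (hk : 1 ≤ k) {L : Fin k → ℤ × ℤ} {B : ℕ} {R : ℝ} {m : Fin k}
    {r : Fin k → ℕ} (hr : r ∈ dkBoxP L B R m) :
    ∑ s ∈ (dkBoxP L B R m).filter (fun s => (∏ i, s i) = ∏ i, r i), matchWt r s (∏ i, r i) ≤
      ∏ q ∈ (∏ i, r i).primeFactors, ((q : ℝ) + k - 2) := by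
  classical
  have hrbox : r ∈ dkBox L B R := dkBoxP_subset L B R m hr
  have h := sum_matchWt_le hk (L := L) (B := B) (R := R) (∏ i, r i) r hrbox rfl ∅ (Finset.empty_subset _)
  simp only [Finset.notMem_empty, IsEmpty.forall_iff, implies_true, and_true, Finset.card_empty, pow_zero,
    one_mul, Finset.sdiff_empty] at h
  refine le_trans (Finset.sum_le_sum_of_subset_of_nonneg (fun s hs => ?_) fun s _ _ => matchWt_nonneg r s _) h
  obtain ⟨hsD, hse⟩ := Finset.mem_filter.1 hs
  exact Finset.mem_filter.2 ⟨dkBoxP_subset L B R m hsD, hse⟩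

/-! ### §6 The leaf-M3 kernel bound -/

set_option maxHeartbeats 400000 in
/-- **`E_diff^{(m)}` reduced to one `(k−1)`-fold sum.** If `|y^{(m)}_r − c∫F(u(r);t_m)dt_m| ≤ δ c ∫F₂(u(r);t_m)dt_m`
for all `r ∈ 𝒟'` (Lemma 9.3 with `c = (log R) c_M`, `δ ≍ T_k(log log R)²/log R`), then
`|E_diff^{(m)}| ≤ 2c²(1/k + δ)·((30+30/U_k+T_k)·6 log 4/log R + δ) · Σ_{r ∈ 𝒟'} (∫F₂(u(r);t_m)dt_m)² w(∏r)`,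
`w(N) = ∏_{q∣N}(q+k−2)/φ_ω(N)²` — everything in the printed argument (9.16)–(9.18) before the appeal to Lemma 8.4.
[cite: Maynard2016DenseClusters, proof of Prop. 9.2 p. 22, (9.16)–(9.18); Lemma 9.3; FordGreenKonyaginMaynardTao2018, Theorem 6 (7.13)] -/
theorem abs_ediffM_le_of_approx {L : Fin k → ℤ × ℤ} (hadm : FormsAdmissible L) (hk : 2 ≤ k)
    {B : ℕ} {R : ℝ} (hR : 1 < R) (m : Fin k) {c δ : ℝ} (hc : 0 ≤ c) (hδ : 0 ≤ δ)
    (happrox : ∀ r ∈ dkBoxP L B R m,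
      |yVarM L B R (MaynardDense.F k) m r - c * margInt m (MaynardDense.F k) (logVec R r)| ≤
        δ * c * margInt m (MaynardDense.F₂ k) (logVec R r)) :
    |ediffM L B R (MaynardDense.F k) m| ≤
      2 * (c ^ 2 * (1 / k + δ)) *
        ((30 + 30 / MaynardDense.U k + MaynardDense.T k) * (6 * Real.log 4) / Real.log R + δ) *
        ∑ r ∈ dkBoxP L B R m, margInt m (MaynardDense.F₂ k) (logVec R r) ^ 2 * wRatio L (∏ i, r i) := by
  classical
  have hk1 : 1 ≤ k := le_trans (by norm_num) hk
  have hlogR : 0 < Real.log R := Real.log_pos hR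
  set D := dkBoxP L B R m with hD
  set Fq : (Fin k → ℕ) → ℝ := fun r => margInt m (MaynardDense.F₂ k) (logVec R r) ^ 2 with hFq
  set Sw := ∑ r ∈ D, Fq r * wRatio L (∏ i, r i) with hSw
  set C := 30 + 30 / MaynardDense.U k + MaynardDense.T k with hC
  have hC0 : 0 ≤ C := by
    have hU : 0 < MaynardDense.U k := by unfold MaynardDense.U; positivity
    have := MaynardDense.T_pos hk
    positivity
  have h1 := abs_ediffM_le_sum_kernels hadm hk hR m hc hδ happrox
  -- the weight `Φ = I₂²` is `≥ 0` and non-decreasing under removing primes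
  have hΦ0 : ∀ r, 0 ≤ Fq r := fun r => sq_nonneg _
  have hΦ : ∀ r ∈ D, ∀ (j : Fin k) (p : ℕ), p.Prime → p ∣ r j →
      Fq r ≤ Fq (Function.update r j (r j / p)) := by
    intro r hr j p hp hpj
    have hrbox := dkBoxP_subset L B R m hr
    have hr1 : ∀ i, 1 ≤ r i := one_le_of_mem_dkBox hrbox
    have hr' : Function.update r j (r j / p) ∈ dkBox L B R := update_div_mem_dkBox hrbox j hpj
    have hr'1 : ∀ i, 1 ≤ Function.update r j (r j / p) i := one_le_of_mem_dkBox hr'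
    have hle : ∀ i, Function.update r j (r j / p) i ≤ r i := by
      intro i
      by_cases hi : i = j
      · subst hi; simp only [Function.update_self]; exact Nat.div_le_self _ _
      · simp only [Function.update_of_ne hi]; exact le_rfl
    have huv : ∀ i, logVec R (Function.update r j (r j / p)) i ≤ logVec R r i := by
      intro i
      unfold logVec
      exact div_le_div_of_nonneg_right (Real.log_le_log (by exact_mod_cast hr'1 i)
        (by exact_mod_cast hle i)) hlogR.le
    have hanti := margInt_F₂_anti hk (logVec_mem_orthant hR.le _ hr'1) huv m
    have h0 : 0 ≤ margInt m (MaynardDense.F₂ k) (logVec R r) :=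
      margInt_F₂_nonneg hk (logVec_mem_orthant hR.le r hr1) m
    exact pow_le_pow_left₀ h0 hanti 2
  have hlog := sum_kernel_le_dkBoxP hk hadm (B := B) (R := R) (m := m) hΦ0 hΦ
  have hcnt : ∑ r ∈ D, Fq r / phiOmega L (∏ i, r i) ^ 2 *
      ∑ s ∈ D.filter (fun s => (∏ i, s i) = ∏ i, r i), matchWt r s (∏ i, r i) ≤ Sw := by
    refine Finset.sum_le_sum fun r hr => ?_
    have h := sum_filter_matchWt_le_dkBoxP hk1 (L := L) (B := B) (R := R) (m := m) hr
    have hFq0 : 0 ≤ Fq r / phiOmega L (∏ i, r i) ^ 2 := div_nonneg (hΦ0 r) (sq_nonneg _)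
    refine (mul_le_mul_of_nonneg_left h hFq0).trans (le_of_eq ?_)
    unfold wRatio
    ring
  have hC₀ : 0 ≤ 2 * (c ^ 2 * (1 / k + δ)) := by positivity
  refine h1.trans ?_
  have hA : C / Real.log R * (∑ r ∈ D, Fq r / phiOmega L (∏ i, r i) ^ 2 *
      ∑ s ∈ D.filter (fun s => (∏ i, s i) = ∏ i, r i),
        Real.log (misProd r s (∏ i, r i)) * matchWt r s (∏ i, r i)) ≤
      C / Real.log R * (6 * Real.log 4 * Sw) :=
    mul_le_mul_of_nonneg_left hlog (div_nonneg hC0 hlogR.le)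
  have hB : δ * (∑ r ∈ D, Fq r / phiOmega L (∏ i, r i) ^ 2 *
      ∑ s ∈ D.filter (fun s => (∏ i, s i) = ∏ i, r i), matchWt r s (∏ i, r i)) ≤ δ * Sw :=
    mul_le_mul_of_nonneg_left hcnt hδ
  calc 2 * (c ^ 2 * (1 / k + δ)) *
        (C / Real.log R * ∑ r ∈ D, Fq r / phiOmega L (∏ i, r i) ^ 2 *
            ∑ s ∈ D.filter (fun s => (∏ i, s i) = ∏ i, r i),
              Real.log (misProd r s (∏ i, r i)) * matchWt r s (∏ i, r i) +
          δ * ∑ r ∈ D, Fq r / phiOmega L (∏ i, r i) ^ 2 *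
            ∑ s ∈ D.filter (fun s => (∏ i, s i) = ∏ i, r i), matchWt r s (∏ i, r i))
      ≤ 2 * (c ^ 2 * (1 / k + δ)) * (C / Real.log R * (6 * Real.log 4 * Sw) + δ * Sw) :=
        mul_le_mul_of_nonneg_left (add_le_add hA hB) hC₀
    _ = 2 * (c ^ 2 * (1 / k + δ)) * (C * (6 * Real.log 4) / Real.log R + δ) * Sw := by ring

end Literature.NumberTheory.Sieve.FGKMT2018
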